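import Summits.MatrixMultiplication.MatrixMultiplication.Theorems.ThresholdSubsetTriples.Negative.RootedStabilisers

/-!
# `ThresholdSubsetTriples` (crux stmt-MatrixMultiplication-10882) — negative-side support IVb:
# the rooted triple `K_1, K_3, K_5` itself violates the triple product property (uniformly in `n ≥ 6`)

Matched pairs `{x, a-x}` may be swapped inside `C(μ_a)` (`swap_mul_reflPerm_comm`) and two matched pairs may
be exchanged (`swap_swap_mul_reflPerm_comm`).  With `x = 2`, `y = n-1` (an `M_1`-pair) and `x' = 1 = 3-x`,
`y' = 4 = 3-y` (an `M_5`-pair): `σ₁ = (x y) ∈ K_1`, `σ₃ = (x y)(x' y') ∈ K_3`, `σ₅ = (x' y') ∈ K_5` and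
`σ₁σ₃σ₅ = 1` with `σ₁ ≠ 1` — so every triple of sets containing `K_1, K_3, K_5` fails the TPP
(`rootedTriple_not_tpp`, `rootedTriple_filter_not_tpp`).  The pairwise-perfect configuration of
`RootedStabilisers.lean` is therefore not a witness for the crux; whether an `e^{-o(√n)}`-fraction
sub-triple has the TPP is the open constructive crux `HyperoctahedralThreshold` (10883).
-/

noncomputable section

set_option linter.dupNamespace false

open scoped BigOperators

namespace Summit.MatrixMultiplication.MatrixMultiplication.Theorems.ThresholdSubsetTriples.Negative

open Summit.MatrixMultiplication.MatrixMultiplication.Theses.SnSubsetDichotomy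
open Summit.MatrixMultiplication.MatrixMultiplication.Theorems
open Literature.Combinatorics.Additive

section NotTPP

open Fin.CommRing

variable {n : ℕ} [NeZero n]

/-- `μ[n, a]`: the matching involution `x ↦ a - x` of `ℤ/n = Fin n` (perfect matching `{x, a - x}` for
`a` odd, `n` even); `K[n, a] = C(μ_a) ∩ Stab(0)`, the rooted matching stabiliser; `KT[n]`, the triple
`K_1, K_3, K_5` (local notations, no new definitions). -/
local notation3 (prettyPrint := false) "μ[" n ", " a "]" => (Equiv.subLeft ((a : ℕ) : Fin n) : Equiv.Perm (Fin n))

local notation3 (prettyPrint := false) "K[" n ", " a "]" =>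
  (Subgroup.centralizer {μ[n, a]} ⊓ MulAction.stabilizer (Equiv.Perm (Fin n)) (0 : Fin n) :
    Subgroup (Equiv.Perm (Fin n)))

/-- Commutation with `μ_a` is the functional equation `σ (a - z) = a - σ z`. -/
theorem mul_reflPerm_comm_of {a : ℕ} {σ : Equiv.Perm (Fin n)}
    (h : ∀ z, σ ((a : Fin n) - z) = (a : Fin n) - σ z) : σ * μ[n, a] = μ[n, a] * σ := by
  ext z
  simp only [Equiv.Perm.mul_apply, Equiv.subLeft_apply]
  rw [h z]

/-- A matched pair `{x, y}` (`x + y = a`) may be swapped inside `C(μ_a)`. -/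
theorem swap_mul_reflPerm_comm {a : ℕ} {x y : Fin n} (hxy : x + y = (a : Fin n)) :
    Equiv.swap x y * μ[n, a] = μ[n, a] * Equiv.swap x y := by
  have hax : (a : Fin n) - x = y := by rw [← hxy]; ring
  have hay : (a : Fin n) - y = x := by rw [← hxy]; ring
  refine mul_reflPerm_comm_of fun z => ?_
  rcases eq_or_ne z x with rfl | hzx
  · rw [hax, Equiv.swap_apply_left, Equiv.swap_apply_right, hay]
  rcases eq_or_ne z y with rfl | hzy
  · rw [hay, Equiv.swap_apply_right, Equiv.swap_apply_left, hax]
  have h1 : (a : Fin n) - z ≠ x := fun h => hzy (by rw [← hax, ← h, sub_sub_cancel])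
  have h2 : (a : Fin n) - z ≠ y := fun h => hzx (by rw [← hay, ← h, sub_sub_cancel])
  rw [Equiv.swap_apply_of_ne_of_ne h1 h2, Equiv.swap_apply_of_ne_of_ne hzx hzy]

/-- Two matched pairs `{x, x'}`, `{y, y'}` (`x + x' = y + y' = a`, four distinct points) may be
exchanged inside `C(μ_a)`: `(x y)(x' y')` commutes with `μ_a`. -/
theorem swap_swap_mul_reflPerm_comm {a : ℕ} {x y x' y' : Fin n} (hx : x + x' = (a : Fin n))
    (hy : y + y' = (a : Fin n)) (hxy : x ≠ y) (hxx' : x ≠ x') (hxy' : x ≠ y') (hyx' : y ≠ x')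
    (hyy' : y ≠ y') (hx'y' : x' ≠ y') :
    (Equiv.swap x y * Equiv.swap x' y') * μ[n, a] =
      μ[n, a] * (Equiv.swap x y * Equiv.swap x' y') := by
  have hax : (a : Fin n) - x = x' := by rw [← hx]; ring
  have hax' : (a : Fin n) - x' = x := by rw [← hx]; ring
  have hay : (a : Fin n) - y = y' := by rw [← hy]; ring
  have hay' : (a : Fin n) - y' = y := by rw [← hy]; ring
  set σ : Equiv.Perm (Fin n) := Equiv.swap x y * Equiv.swap x' y' with hσ
  have eval : ∀ w, σ w = Equiv.swap x y (Equiv.swap x' y' w) := fun w => rfl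
  have σx : σ x = y := by
    rw [eval, Equiv.swap_apply_of_ne_of_ne hxx' hxy', Equiv.swap_apply_left]
  have σy : σ y = x := by
    rw [eval, Equiv.swap_apply_of_ne_of_ne hyx' hyy', Equiv.swap_apply_right]
  have σx' : σ x' = y' := by
    rw [eval, Equiv.swap_apply_left, Equiv.swap_apply_of_ne_of_ne hxy'.symm hyy'.symm]
  have σy' : σ y' = x' := by
    rw [eval, Equiv.swap_apply_right, Equiv.swap_apply_of_ne_of_ne hxx'.symm hyx'.symm]
  have σz : ∀ z, z ≠ x → z ≠ y → z ≠ x' → z ≠ y' → σ z = z := by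
    intro z h1 h2 h3 h4
    rw [eval, Equiv.swap_apply_of_ne_of_ne h3 h4, Equiv.swap_apply_of_ne_of_ne h1 h2]
  refine mul_reflPerm_comm_of fun z => ?_
  rcases eq_or_ne z x with rfl | h1
  · rw [hax, σx', σx, hay]
  rcases eq_or_ne z y with rfl | h2
  · rw [hay, σy', σy, hax]
  rcases eq_or_ne z x' with rfl | h3
  · rw [hax', σx, σx', hay']
  rcases eq_or_ne z y' with rfl | h4
  · rw [hay', σy, σy', hax']
  have g1 : (a : Fin n) - z ≠ x := fun h => h3 (by rw [← hax, ← h, sub_sub_cancel])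
  have g2 : (a : Fin n) - z ≠ y := fun h => h4 (by rw [← hay, ← h, sub_sub_cancel])
  have g3 : (a : Fin n) - z ≠ x' := fun h => h1 (by rw [← hax', ← h, sub_sub_cancel])
  have g4 : (a : Fin n) - z ≠ y' := fun h => h2 (by rw [← hay', ← h, sub_sub_cancel])
  rw [σz _ g1 g2 g3 g4, σz _ h1 h2 h3 h4]

/-- **The rooted triple itself violates the TPP** (`n ≡ 2 mod 4`, `n ≥ 6`): with `x = 2`, `y = n - 1`
(an `M_1`-pair), `x' = 1 = 3 - x`, `y' = 4 = 3 - y` (an `M_5`-pair), the elements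
`σ₁ = (x y) ∈ K_1`, `σ₃ = (x y)(x' y') ∈ K_3`, `σ₅ = (x' y') ∈ K_5` satisfy `σ₁ σ₃ σ₅ = 1`, `σ₁ ≠ 1`. -/
theorem rootedTriple_not_tpp (hn6 : 6 ≤ n) (S₁ S₃ S₅ : Finset (Equiv.Perm (Fin n)))
    (h₁ : ∀ σ, σ ∈ K[n, 1] → σ ∈ S₁) (h₃ : ∀ σ, σ ∈ K[n, 3] → σ ∈ S₃)
    (h₅ : ∀ σ, σ ∈ K[n, 5] → σ ∈ S₅) :
    ¬ TripleProductProperty S₁ S₃ S₅ := by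
  intro hT
  -- the four points
  set x : Fin n := ((2 : ℕ) : Fin n) with hx
  set y : Fin n := ((n - 1 : ℕ) : Fin n) with hy
  set x' : Fin n := ((1 : ℕ) : Fin n) with hx'
  set y' : Fin n := ((4 : ℕ) : Fin n) with hy'
  have vx : x.val = 2 := by rw [hx, Fin.val_natCast]; exact Nat.mod_eq_of_lt (by omega)
  have vy : y.val = n - 1 := by rw [hy, Fin.val_natCast]; exact Nat.mod_eq_of_lt (by omega)
  have vx' : x'.val = 1 := by rw [hx', Fin.val_natCast]; exact Nat.mod_eq_of_lt (by omega)
  have vy' : y'.val = 4 := by rw [hy', Fin.val_natCast]; exact Nat.mod_eq_of_lt (by omega)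
  have v0 : (0 : Fin n).val = 0 := rfl
  have hxy : x ≠ y := fun h => by have := congrArg Fin.val h; omega
  have hxx' : x ≠ x' := fun h => by have := congrArg Fin.val h; omega
  have hxy' : x ≠ y' := fun h => by have := congrArg Fin.val h; omega
  have hyx' : y ≠ x' := fun h => by have := congrArg Fin.val h; omega
  have hyy' : y ≠ y' := fun h => by have := congrArg Fin.val h; omega
  have hx'y' : x' ≠ y' := fun h => by have := congrArg Fin.val h; omega
  have h0x : (0 : Fin n) ≠ x := fun h => by have := congrArg Fin.val h; omega
  have h0y : (0 : Fin n) ≠ y := fun h => by have := congrArg Fin.val h; omega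
  have h0x' : (0 : Fin n) ≠ x' := fun h => by have := congrArg Fin.val h; omega
  have h0y' : (0 : Fin n) ≠ y' := fun h => by have := congrArg Fin.val h; omega
  -- the sums
  have hn1 : 1 ≤ n := by omega
  have sum1 : x + y = ((1 : ℕ) : Fin n) := by
    rw [hx, hy, ← Nat.cast_add, show 2 + (n - 1) = n + 1 by omega, Nat.cast_add, Fin.natCast_self,
      zero_add]
  have sum5 : x' + y' = ((5 : ℕ) : Fin n) := by rw [hx', hy', ← Nat.cast_add]
  have sum3x : x + x' = ((3 : ℕ) : Fin n) := by rw [hx, hx', ← Nat.cast_add]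
  have sum3y : y + y' = ((3 : ℕ) : Fin n) := by
    rw [hy, hy', ← Nat.cast_add, show n - 1 + 4 = n + 3 by omega, Nat.cast_add, Fin.natCast_self,
      zero_add]
  -- the three elements
  set σ₁ : Equiv.Perm (Fin n) := Equiv.swap x y
  set σ₅ : Equiv.Perm (Fin n) := Equiv.swap x' y'
  set σ₃ : Equiv.Perm (Fin n) := Equiv.swap x y * Equiv.swap x' y'
  have m₁ : σ₁ ∈ K[n, 1] :=
    mem_rootedStab.2 ⟨swap_mul_reflPerm_comm sum1, Equiv.swap_apply_of_ne_of_ne h0x h0y⟩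
  have m₅ : σ₅ ∈ K[n, 5] :=
    mem_rootedStab.2 ⟨swap_mul_reflPerm_comm sum5, Equiv.swap_apply_of_ne_of_ne h0x' h0y'⟩
  have m₃ : σ₃ ∈ K[n, 3] := by
    refine mem_rootedStab.2 ⟨swap_swap_mul_reflPerm_comm sum3x sum3y hxy hxx' hxy' hyx' hyy' hx'y', ?_⟩
    show Equiv.swap x y (Equiv.swap x' y' 0) = 0
    rw [Equiv.swap_apply_of_ne_of_ne h0x' h0y', Equiv.swap_apply_of_ne_of_ne h0x h0y]
  have one₁ : (1 : Equiv.Perm (Fin n)) ∈ S₁ := h₁ 1 (K[n, 1]).one_mem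
  have one₃ : (1 : Equiv.Perm (Fin n)) ∈ S₃ := h₃ 1 (K[n, 3]).one_mem
  have one₅ : (1 : Equiv.Perm (Fin n)) ∈ S₅ := h₅ 1 (K[n, 5]).one_mem
  have rel : σ₁ * 1⁻¹ * (σ₃ * 1⁻¹) * (σ₅ * 1⁻¹) = 1 := by
    simp only [inv_one, mul_one]
    show Equiv.swap x y * (Equiv.swap x y * Equiv.swap x' y') * Equiv.swap x' y' = 1
    rw [← mul_assoc, Equiv.swap_mul_self, one_mul, Equiv.swap_mul_self]
  have key := hT σ₁ (h₁ _ m₁) 1 one₁ σ₃ (h₃ _ m₃) 1 one₃ σ₅ (h₅ _ m₅) 1 one₅ rel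
  have : σ₁ = 1 := key.1
  rw [Equiv.Perm.one_def, Equiv.swap_eq_refl_iff] at this
  exact hxy this


/-- The rooted triple `K_1, K_3, K_5` as `Finset`s is NOT a TPP triple (`n ≡ 2 mod 4`, `n ≥ 6`): the
pairwise-perfect configuration of `thresholdSubsetTriplesPairwise_holds` fails the three-fold condition
at every `n`; whether a sub-triple of index `e^{o(√n)}` has the TPP is exactly the open constructive crux
`HyperoctahedralThreshold` (10883) / its negation inside `HyperoctahedralSubsets` (8305). -/
theorem rootedTriple_filter_not_tpp (hn6 : 6 ≤ n) [DecidablePred (· ∈ K[n, 1])]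
    [DecidablePred (· ∈ K[n, 3])] [DecidablePred (· ∈ K[n, 5])] :
    ¬ TripleProductProperty (Finset.univ.filter (· ∈ K[n, 1]))
      (Finset.univ.filter (· ∈ K[n, 3])) (Finset.univ.filter (· ∈ K[n, 5])) :=
  rootedTriple_not_tpp hn6 _ _ _ (fun σ h => by simpa using h) (fun σ h => by simpa using h)
    (fun σ h => by simpa using h)


end NotTPP

end Summit.MatrixMultiplication.MatrixMultiplication.Theorems.ThresholdSubsetTriples.Negative

end
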